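import Mathlib.Analysis.Complex.AbsMax
import Mathlib.Analysis.Complex.LocallyUniformLimit
import Mathlib.Analysis.Complex.CauchyIntegral
import Mathlib.Analysis.Analytic.IsolatedZeros

/-!
# Hurwitz's theorems (zeros and univalence) for locally uniform limits

Crux `WitnessCharge` (statement item `stmt-SmoothPoincare4-7824`), line `Sketch`,
stubs `helper_hurwitz` and `helper_hurwitzInjective`.

Both statements are proved from the **maximum modulus principle**
(`Complex.norm_le_of_forall_mem_frontier_norm_le`) instead of the argument principle:
if the locally uniform limit `f` of holomorphic functions `F n` takes the value `c` at an
isolated point `z₀`, then for all large `n` the function `F n` takes the value `c` somewhere in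
any prescribed small disc around `z₀` (otherwise `(F n - c)⁻¹` would be holomorphic on the disc,
bounded by `2/m` on its boundary circle, where `m > 0` is the minimum of `‖f - c‖` on that circle,
while `‖F n z₀ - c‖ → 0`).

## Main results

* `helper_hurwitz`: a locally uniform limit, on a preconnected open set, of nowhere vanishing
  holomorphic functions is either identically zero or nowhere vanishing.
* `helper_hurwitzInjective`: a locally uniform limit, on a preconnected open set, of injective
  holomorphic functions is either constant or injective.
-/

noncomputable section

set_option linter.dupNamespace false

open Set Filter Topology Metric

namespace Summit.SmoothPoincare4.SmoothPoincare4.Theorems.WitnessCharge.PencilIncompleteness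

/-- **Local persistence of values under locally uniform limits.** Let `F n → f` locally
uniformly on an open set `U ⊆ ℂ`, with every `F n` holomorphic on `U`. If `f z₀ = c` at a point
`z₀ ∈ U` near which `f` does not take the value `c` again (punctured neighbourhood), then for
every `ρ > 0` there is a radius `0 < r ≤ ρ` with `closedBall z₀ r ⊆ U` such that, for all large
`n`, `F n` takes the value `c` somewhere in the open disc `ball z₀ r`. The proof is the maximum
modulus principle applied to `(F n · - c)⁻¹` on `ball z₀ r`. -/
theorem helper_hurwitz_eventually_exists_eq
    {U : Set ℂ} (hU : IsOpen U) {F : ℕ → ℂ → ℂ} {f : ℂ → ℂ}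
    (hF : ∀ n, DifferentiableOn ℂ (F n) U)
    (hlim : TendstoLocallyUniformlyOn F f atTop U)
    {z₀ : ℂ} (hz₀ : z₀ ∈ U) {c : ℂ} (hf0 : f z₀ = c)
    (hne : ∀ᶠ z in 𝓝[≠] z₀, f z ≠ c) {ρ : ℝ} (hρ : 0 < ρ) :
    ∃ r, 0 < r ∧ r ≤ ρ ∧ closedBall z₀ r ⊆ U ∧
      ∀ᶠ n in atTop, ∃ z ∈ ball z₀ r, F n z = c := by
  -- the limit is holomorphic, hence continuous, on `U`
  have hfd : DifferentiableOn ℂ f U := hlim.differentiableOn (Eventually.of_forall hF) hU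
  have hfc : ContinuousOn f U := hfd.continuousOn
  -- choose the radius
  obtain ⟨r₁, hr₁, hr₁U⟩ : ∃ r₁, 0 < r₁ ∧ closedBall z₀ r₁ ⊆ U :=
    nhds_basis_closedBall.mem_iff.mp (hU.mem_nhds hz₀)
  obtain ⟨r₂, hr₂, hr₂f⟩ :
      ∃ r₂, 0 < r₂ ∧ ∀ ⦃z⦄, z ∈ closedBall z₀ r₂ → z ∈ ({z₀}ᶜ : Set ℂ) → f z ≠ c := by
    rw [eventually_nhdsWithin_iff, nhds_basis_closedBall.eventually_iff] at hne
    exact hne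
  set r := min (min r₁ r₂) ρ with hr_def
  have hr : 0 < r := lt_min (lt_min hr₁ hr₂) hρ
  have hrρ : r ≤ ρ := min_le_right _ _
  have hrr₁ : r ≤ r₁ := (min_le_left _ _).trans (min_le_left _ _)
  have hrr₂ : r ≤ r₂ := (min_le_left _ _).trans (min_le_right _ _)
  have hsub : closedBall z₀ r ⊆ U := (closedBall_subset_closedBall hrr₁).trans hr₁U
  have hsph : ∀ z ∈ sphere z₀ r, f z ≠ c := fun z hz =>
    hr₂f (closedBall_subset_closedBall hrr₂ (sphere_subset_closedBall hz))
      (mem_compl_singleton_iff.mpr (ne_of_mem_sphere hz hr.ne'))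
  refine ⟨r, hr, hrρ, hsub, ?_⟩
  -- minimum `m > 0` of `‖f - c‖` on the circle
  obtain ⟨w, hw, hwmin⟩ := (isCompact_sphere z₀ r).exists_isMinOn
    (NormedSpace.sphere_nonempty.mpr hr.le)
    (((hfc.mono (sphere_subset_closedBall.trans hsub)).sub continuousOn_const).norm)
  set m : ℝ := ‖f w - c‖ with hm_def
  have hm : 0 < m := norm_pos_iff.mpr (sub_ne_zero.mpr (hsph w hw))
  have hmle : ∀ z ∈ sphere z₀ r, m ≤ ‖f z - c‖ := fun z hz => isMinOn_iff.mp hwmin z hz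
  -- uniform convergence on the closed disc
  have hunif : TendstoUniformlyOn F f atTop (closedBall z₀ r) :=
    (tendstoLocallyUniformlyOn_iff_forall_isCompact hU).mp hlim _ hsub (isCompact_closedBall _ _)
  filter_upwards [Metric.tendstoUniformlyOn_iff.mp hunif (m / 2) (half_pos hm)] with n hn
  -- `hn : ∀ z ∈ closedBall z₀ r, dist (f z) (F n z) < m / 2`
  by_contra hcon
  push Not at hcon
  -- lower bound for `‖F n - c‖` on the circle
  have hsph' : ∀ z ∈ sphere z₀ r, m / 2 ≤ ‖F n z - c‖ := by
    intro z hz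
    have h1 := hmle z hz
    have h2 := hn z (sphere_subset_closedBall hz)
    rw [dist_eq_norm] at h2
    have h3 := norm_sub_le_norm_sub_add_norm_sub (f z) (F n z) c
    linarith
  -- `F n - c` does not vanish on the closed disc
  have hne' : ∀ z ∈ closedBall z₀ r, F n z ≠ c := by
    intro z hz
    rcases (mem_closedBall.mp hz).lt_or_eq with hlt | heq
    · exact hcon z (mem_ball.mpr hlt)
    · intro h
      have h1 := hsph' z (mem_sphere.mpr heq)
      rw [h, sub_self, norm_zero] at h1
      linarith
  -- maximum modulus principle for `(F n · - c)⁻¹` on the disc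
  have hg : DiffContOnCl ℂ (fun z => (F n z - c)⁻¹) (ball z₀ r) := by
    refine DifferentiableOn.diffContOnCl ?_
    rw [closure_ball z₀ hr.ne']
    exact (((hF n).mono hsub).sub_const c).inv fun z hz => sub_ne_zero.mpr (hne' z hz)
  have hbound : ‖(F n z₀ - c)⁻¹‖ ≤ 2 / m := by
    refine Complex.norm_le_of_forall_mem_frontier_norm_le isBounded_ball hg ?_
      (subset_closure (mem_ball_self hr))
    intro z hz
    rw [frontier_ball z₀ hr.ne'] at hz
    have h1 := hsph' z hz
    have h2 : 0 < ‖F n z - c‖ := lt_of_lt_of_le (half_pos hm) h1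
    rw [norm_inv, inv_le_comm₀ h2 (by positivity), inv_div]
    exact h1
  -- but `‖F n z₀ - c‖ < m / 2`
  have h3 := hn z₀ (mem_closedBall_self hr.le)
  rw [dist_eq_norm, hf0, norm_sub_rev] at h3
  have h4 : 0 < ‖F n z₀ - c‖ :=
    norm_pos_iff.mpr (sub_ne_zero.mpr (hne' z₀ (mem_closedBall_self hr.le)))
  rw [norm_inv, inv_le_comm₀ h4 (by positivity), inv_div] at hbound
  linarith

/-- **Hurwitz's theorem (zeros).** Let `U ⊆ ℂ` be open and preconnected, and let holomorphic
functions `F n : U → ℂ` without zeros on `U` converge locally uniformly on `U` to `f`. Then the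
limit `f` is either identically zero on `U` or has no zeros on `U`: zeros of holomorphic
functions do not disappear in locally uniform limits. Proof: `f` is holomorphic on `U`; if
`f z₀ = 0` and `f` is not identically zero near `z₀`, the zero `z₀` is isolated (identity
theorem on the preconnected `U` otherwise forces `f ≡ 0`), and the maximum modulus principle
applied to `(F n)⁻¹` on a small disc around `z₀` produces a zero of `F n` for `n` large
(`helper_hurwitz_eventually_exists_eq`), a contradiction. -/
theorem helper_hurwitz :
    ∀ (U : Set ℂ), IsOpen U → IsPreconnected U →
    ∀ (F : ℕ → ℂ → ℂ) (f : ℂ → ℂ),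
      (∀ n, DifferentiableOn ℂ (F n) U) → (∀ n, ∀ z ∈ U, F n z ≠ 0) →
      TendstoLocallyUniformlyOn F f atTop U →
      (∀ z ∈ U, f z = 0) ∨ (∀ z ∈ U, f z ≠ 0) := by
  intro U hU hUc F f hF hF0 hlim
  by_cases h : ∀ z ∈ U, f z ≠ 0
  · exact Or.inr h
  left
  push Not at h
  obtain ⟨z₀, hz₀, hfz₀⟩ := h
  have hfa : AnalyticOnNhd ℂ f U :=
    (hlim.differentiableOn (Eventually.of_forall hF) hU).analyticOnNhd hU
  rcases (hfa z₀ hz₀).eventually_eq_zero_or_eventually_ne_zero with h0 | hne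
  · exact fun z hz => hfa.eqOn_zero_of_preconnected_of_eventuallyEq_zero hUc hz₀ h0 hz
  · exfalso
    obtain ⟨r, -, -, hsub, hev⟩ :=
      helper_hurwitz_eventually_exists_eq hU hF hlim hz₀ hfz₀ hne zero_lt_one
    obtain ⟨n, z, hz, hFz⟩ := hev.exists
    exact hF0 n z (hsub (ball_subset_closedBall hz)) hFz

/-- **Hurwitz's theorem (univalence).** Let `U ⊆ ℂ` be open and preconnected, and let
injective holomorphic functions `F n` converge locally uniformly on `U` to `f`. Then the limit
`f` is either constant on `U` or injective on `U`. Proof: if `f` is not constant and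
`f a = f a'` with `a ≠ a'` in `U`, put `c := f a`; by the identity theorem `f - c` is not
identically zero near `a` nor near `a'`, so by the maximum modulus argument
(`helper_hurwitz_eventually_exists_eq`) applied on two disjoint small discs around `a` and `a'`,
for `n` large `F n` takes the value `c` in both discs, contradicting the injectivity of `F n`. -/
theorem helper_hurwitzInjective :
    ∀ (U : Set ℂ), IsOpen U → IsPreconnected U →
    ∀ (F : ℕ → ℂ → ℂ) (f : ℂ → ℂ),
      (∀ n, DifferentiableOn ℂ (F n) U) → (∀ n, InjOn (F n) U) →
      TendstoLocallyUniformlyOn F f atTop U →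
      (∃ c : ℂ, ∀ z ∈ U, f z = c) ∨ InjOn f U := by
  intro U hU hUc F f hF hFi hlim
  by_cases hc : ∃ c : ℂ, ∀ z ∈ U, f z = c
  · exact Or.inl hc
  right
  intro a ha a' ha' heq
  by_contra hne
  have hfa : AnalyticOnNhd ℂ f U :=
    (hlim.differentiableOn (Eventually.of_forall hF) hU).analyticOnNhd hU
  -- `f - f a` is not identically zero near any point of `U` where it vanishes
  have key : ∀ b ∈ U, ∀ᶠ z in 𝓝[≠] b, f z ≠ f a := by
    intro b hb
    rcases (hfa b hb).eventually_eq_or_eventually_ne analyticAt_const with h0 | h1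
    · exact absurd ⟨f a, fun z hz =>
        hfa.eqOn_of_preconnected_of_eventuallyEq analyticOnNhd_const hUc hb h0 hz⟩ hc
    · exact h1
  -- two disjoint discs
  set ρ : ℝ := dist a a' / 2 with hρ_def
  have hρ : 0 < ρ := half_pos (dist_pos.mpr hne)
  obtain ⟨r, -, hrρ, hsub, hev⟩ :=
    helper_hurwitz_eventually_exists_eq hU hF hlim ha rfl (key a ha) hρ
  obtain ⟨r', -, hr'ρ, hsub', hev'⟩ :=
    helper_hurwitz_eventually_exists_eq hU hF hlim ha' heq.symm (key a' ha') hρ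
  obtain ⟨n, ⟨z, hz, hFz⟩, ⟨z', hz', hFz'⟩⟩ := (hev.and hev').exists
  have hzz' : z = z' :=
    hFi n (hsub (ball_subset_closedBall hz)) (hsub' (ball_subset_closedBall hz')) (hFz.trans hFz'.symm)
  subst hzz'
  have h1 : dist z a < ρ := lt_of_lt_of_le (mem_ball.mp hz) hrρ
  have h2 : dist z a' < ρ := lt_of_lt_of_le (mem_ball.mp hz') hr'ρ
  have h3 := dist_triangle_left a a' z
  linarith

end Summit.SmoothPoincare4.SmoothPoincare4.Theorems.WitnessCharge.PencilIncompleteness
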